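import Summits.AtomisticToContinuum.HydrodynamicLimit.Theorems.EnskogAdjointDualityEquilibriumCollisionResidualCentring
import Summits.AtomisticToContinuum.HydrodynamicLimit.Theorems.EnskogAdjointDualityDualityReductionLBound
import Summits.AtomisticToContinuum.HydrodynamicLimit.Theorems.EnskogAdjointDualityDualityReductionLMeasurable
import Summits.AtomisticToContinuum.HydrodynamicLimit.Theorems.CorrectorPressureDecay.Negative.Frame
import HarnessLib

/-!
# K2R corrector balance II: the Gaussian coupling and the position slice

Route `EnskogAdjointDuality` of `AtomisticToContinuum/HydrodynamicLimit`, crux `AdjointEnskogTestFamilyR`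
(stmt-AtomisticToContinuum-11592, "K2R"), line `birth`, stub `stub_correctorBalance` (B4): the corrector `κ` of
the test family `φ^N = ψ^N + κ^N/λ_N` pairs to `O(ε)` with the test-side Enskog operator against the Euler
local Maxwellian `f = ρ₀ M_{1,θ₀,u₀}` (local detailed balance: the `λ_N` of the operator cancels the `1/λ_N`
of the corrector, and the equal-position bracket integrates to zero).
This file holds the bookkeeping that does not see the detailed-balance cancellation:

* `k2r_abs_sqrt_sub_sqrt_mul_le`, `k2r_coupling_norm_sq_le`, `k2r_coupling_sub_le`,
  `k2r_integrable_comp_coupling` — the Gaussian coupling `w = u + √θ z` (`z ∼ γ`) of two local Maxwellians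
  with parameters in a compact range: size and distance of the coupled velocities, integrability along it;
* `k2r_corrector_position` — for a fixed position `x`: Fubini `v ↔ ω` under Gaussian-moment domination and
  the bounded prefactors `|Y| ≤ Ȳ`, `|ρ₀| ≤ R` reduce the `v`-slice of the corrector pairing to the
  direction-wise Maxwellian-weighted brackets;
* `stub_correctorBalance_position` — the registered sub-goal (closed form of `k2r_corrector_position`).

References: C. Cercignani, R. Illner, M. Pulvirenti, *The Mathematical Theory of Dilute Gases* (1994), §3.1
(collision kinematics, detailed balance) [CIP1994].
-/

noncomputable section

open MeasureTheory ProbabilityTheory Metric Set Filter Topology Function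
open scoped InnerProductSpace ENNReal

namespace Summit.AtomisticToContinuum.HydrodynamicLimit.Theorems.EnskogAdjointDuality

open Literature.Analysis.FluidPDE Literature.MathematicalPhysics.KineticTheory

/-! ## A kernel bound -/

/-- `|((v−w)·ω)₊| ≤ (1 + |v|²)(1 + |w|²)` for a unit vector `ω`. [folklore] -/
theorem k2r_abs_posPart_inner_le (ω : sphere (0 : V3) 1) (v w : V3) :
    |max ⟪v - w, (ω : V3)⟫_ℝ 0| ≤ (1 + ‖v‖ ^ 2) * (1 + ‖w‖ ^ 2) := by
  rw [abs_of_nonneg (le_max_right _ _)]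
  have h1 : max ⟪v - w, (ω : V3)⟫_ℝ 0 ≤ ‖v - w‖ := by
    refine max_le ?_ (norm_nonneg _)
    have h := abs_real_inner_le_norm (v - w) (ω : V3)
    rw [norm_eq_of_mem_sphere ω, mul_one] at h
    exact (le_abs_self _).trans h
  have h2 : ‖v - w‖ ≤ ‖v‖ + ‖w‖ := norm_sub_le v w
  nlinarith [sq_nonneg (‖v‖ - 1), sq_nonneg (‖w‖ - 1), norm_nonneg v, norm_nonneg w,
    mul_nonneg (sq_nonneg ‖v‖) (sq_nonneg ‖w‖)]

/-! ## The Gaussian coupling -/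

/-- Square roots are Lipschitz away from zero: `|√θ′ − √θ| · 2√θm ≤ |θ′ − θ|` for `θ, θ′ ≥ θm > 0`.
[folklore] -/
theorem k2r_abs_sqrt_sub_sqrt_mul_le {θm θ θ' : ℝ} (hθm : 0 < θm) (hθ : θm ≤ θ) (hθ' : θm ≤ θ') :
    |Real.sqrt θ' - Real.sqrt θ| * (2 * Real.sqrt θm) ≤ |θ' - θ| := by
  have h0 : 0 ≤ θ := hθm.le.trans hθ
  have h0' : 0 ≤ θ' := hθm.le.trans hθ'
  have hs : Real.sqrt θm ≤ Real.sqrt θ := Real.sqrt_le_sqrt hθ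
  have hs' : Real.sqrt θm ≤ Real.sqrt θ' := Real.sqrt_le_sqrt hθ'
  have hsum : 2 * Real.sqrt θm ≤ Real.sqrt θ' + Real.sqrt θ := by linarith
  have hkey : (Real.sqrt θ' - Real.sqrt θ) * (Real.sqrt θ' + Real.sqrt θ) = θ' - θ := by
    have e1 := Real.mul_self_sqrt h0
    have e2 := Real.mul_self_sqrt h0'
    ring_nf
    nlinarith [e1, e2]
  calc |Real.sqrt θ' - Real.sqrt θ| * (2 * Real.sqrt θm)
      ≤ |Real.sqrt θ' - Real.sqrt θ| * (Real.sqrt θ' + Real.sqrt θ) :=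
        mul_le_mul_of_nonneg_left hsum (abs_nonneg _)
    _ = |Real.sqrt θ' - Real.sqrt θ| * |Real.sqrt θ' + Real.sqrt θ| := by
        rw [abs_of_nonneg (add_nonneg (Real.sqrt_nonneg _) (Real.sqrt_nonneg _))]
    _ = |θ' - θ| := by rw [← abs_mul, hkey]

/-- The coupled velocities stay in a Gaussian-weighted ball: for `‖u‖ ≤ U`, `0 ≤ θ ≤ Θ`,
`1 + ‖u + √θ z‖² ≤ (1 + 2U² + 2Θ)(1 + ‖z‖²)`. [folklore] -/
theorem k2r_coupling_norm_sq_le {U Θ θ : ℝ} {u : V3} (hu : ‖u‖ ≤ U) (hθ0 : 0 ≤ θ) (hθΘ : θ ≤ Θ)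
    (z : V3) : 1 + ‖u + Real.sqrt θ • z‖ ^ 2 ≤ (1 + 2 * U ^ 2 + 2 * Θ) * (1 + ‖z‖ ^ 2) := by
  have hΘ : 0 ≤ Θ := hθ0.trans hθΘ
  have h1 : ‖u + Real.sqrt θ • z‖ ≤ ‖u‖ + Real.sqrt θ * ‖z‖ := by
    calc ‖u + Real.sqrt θ • z‖ ≤ ‖u‖ + ‖Real.sqrt θ • z‖ := norm_add_le _ _
      _ = ‖u‖ + Real.sqrt θ * ‖z‖ := by
          rw [norm_smul, Real.norm_eq_abs, abs_of_nonneg (Real.sqrt_nonneg θ)]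
  have h2 : ‖u + Real.sqrt θ • z‖ ^ 2 ≤ (‖u‖ + Real.sqrt θ * ‖z‖) ^ 2 :=
    pow_le_pow_left₀ (norm_nonneg _) h1 2
  have h3 : (‖u‖ + Real.sqrt θ * ‖z‖) ^ 2 ≤ 2 * ‖u‖ ^ 2 + 2 * (θ * ‖z‖ ^ 2) := by
    have e : (Real.sqrt θ * ‖z‖) ^ 2 = θ * ‖z‖ ^ 2 := by rw [mul_pow, Real.sq_sqrt hθ0]
    nlinarith [sq_nonneg (‖u‖ - Real.sqrt θ * ‖z‖), e]
  have h4 : ‖u‖ ^ 2 ≤ U ^ 2 := pow_le_pow_left₀ (norm_nonneg _) hu 2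
  have h5 : θ * ‖z‖ ^ 2 ≤ Θ * ‖z‖ ^ 2 := mul_le_mul_of_nonneg_right hθΘ (sq_nonneg _)
  nlinarith [sq_nonneg ‖z‖, mul_nonneg (sq_nonneg U) (sq_nonneg ‖z‖), hΘ]

/-- The coupling distance: for `θ, θ′ ≥ θm > 0`,
`d + ‖(u′ + √θ′ z) − (u + √θ z)‖ ≤ (1 + (2√θm)⁻¹)(1 + ‖z‖²)(d + |θ − θ′| + ‖u − u′‖)` (`d ≥ 0`). [folklore] -/
theorem k2r_coupling_sub_le {θm θ θ' : ℝ} (hθm : 0 < θm) (hθ : θm ≤ θ) (hθ' : θm ≤ θ') (u u' z : V3)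
    {d : ℝ} (hd : 0 ≤ d) :
    d + ‖(u' + Real.sqrt θ' • z) - (u + Real.sqrt θ • z)‖ ≤
      (1 + (2 * Real.sqrt θm)⁻¹) * (1 + ‖z‖ ^ 2) * (d + |θ - θ'| + ‖u - u'‖) := by
  have hsm : 0 < 2 * Real.sqrt θm := mul_pos two_pos (Real.sqrt_pos.2 hθm)
  set L : ℝ := 1 + (2 * Real.sqrt θm)⁻¹ with hL
  set W : ℝ := 1 + ‖z‖ ^ 2 with hW
  have hL1 : 1 ≤ L := le_add_of_nonneg_right (inv_nonneg.2 hsm.le)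
  have hW1 : 1 ≤ W := le_add_of_nonneg_right (sq_nonneg _)
  have hzW : ‖z‖ ≤ W := by rw [hW]; nlinarith [sq_nonneg (‖z‖ - 1), norm_nonneg z]
  have hLW1 : 1 ≤ L * W := one_le_mul_of_one_le_of_one_le hL1 hW1
  -- the velocity difference
  have hsq : |Real.sqrt θ' - Real.sqrt θ| ≤ (2 * Real.sqrt θm)⁻¹ * |θ - θ'| := by
    rw [abs_sub_comm θ θ', ← div_eq_inv_mul, le_div_iff₀ hsm]
    exact k2r_abs_sqrt_sub_sqrt_mul_le hθm hθ hθ'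
  have hdiff : ‖(u' + Real.sqrt θ' • z) - (u + Real.sqrt θ • z)‖ ≤
      ‖u - u'‖ + (2 * Real.sqrt θm)⁻¹ * |θ - θ'| * ‖z‖ := by
    have e : (u' + Real.sqrt θ' • z) - (u + Real.sqrt θ • z) =
        (u' - u) + (Real.sqrt θ' - Real.sqrt θ) • z := by
      rw [sub_smul]; abel
    rw [e]
    calc ‖(u' - u) + (Real.sqrt θ' - Real.sqrt θ) • z‖
        ≤ ‖u' - u‖ + ‖(Real.sqrt θ' - Real.sqrt θ) • z‖ := norm_add_le _ _
      _ = ‖u - u'‖ + |Real.sqrt θ' - Real.sqrt θ| * ‖z‖ := by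
          rw [norm_sub_rev, norm_smul, Real.norm_eq_abs]
      _ ≤ ‖u - u'‖ + (2 * Real.sqrt θm)⁻¹ * |θ - θ'| * ‖z‖ := by
          gcongr
  -- each of the three nonnegative pieces is at most `L W` times itself
  have e1 : d ≤ L * W * d := le_mul_of_one_le_left hd hLW1
  have e2 : ‖u - u'‖ ≤ L * W * ‖u - u'‖ := le_mul_of_one_le_left (norm_nonneg _) hLW1
  have e3 : (2 * Real.sqrt θm)⁻¹ * |θ - θ'| * ‖z‖ ≤ L * W * |θ - θ'| := by
    have hi : (2 * Real.sqrt θm)⁻¹ ≤ L := by rw [hL]; linarith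
    calc (2 * Real.sqrt θm)⁻¹ * |θ - θ'| * ‖z‖ = (2 * Real.sqrt θm)⁻¹ * ‖z‖ * |θ - θ'| := by ring
      _ ≤ L * W * |θ - θ'| := by
          refine mul_le_mul_of_nonneg_right ?_ (abs_nonneg _)
          exact mul_le_mul hi hzW (norm_nonneg _) (zero_le_one.trans hL1)
  calc d + ‖(u' + Real.sqrt θ' • z) - (u + Real.sqrt θ • z)‖
      ≤ d + (‖u - u'‖ + (2 * Real.sqrt θm)⁻¹ * |θ - θ'| * ‖z‖) := by linarith only [hdiff]
    _ ≤ L * W * d + (L * W * ‖u - u'‖ + L * W * |θ - θ'|) := add_le_add e1 (add_le_add e2 e3)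
    _ = L * W * (d + |θ - θ'| + ‖u - u'‖) := by ring

/-- Integrability of a continuous velocity function of growth `K (1+|w|²)²` along the Gaussian coupling
`w = u₁ + √θ₁ z`, `z ∼ γ` (standard Gaussian). [folklore] -/
theorem k2r_integrable_comp_coupling {g : V3 → ℝ} (hg : Continuous g) {K : ℝ}
    (hK : ∀ w, |g w| ≤ K * (1 + ‖w‖ ^ 2) ^ 2) (u₁ : V3) {θ₁ : ℝ} (hθ₁ : 0 ≤ θ₁) :
    Integrable (fun z : V3 => g (u₁ + Real.sqrt θ₁ • z)) (stdGaussian V3) := by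
  have hK0 : 0 ≤ K := by
    have h := (abs_nonneg _).trans (hK 0)
    simpa using h
  have hG : Integrable (fun z : V3 => (1 + ‖z‖ ^ 2) ^ 2) (stdGaussian V3) := by
    rw [← CorrectorPressureDecayNegative.gaussMeasure_zero_one]
    exact integrable_one_add_norm_sq_pow_gaussMeasure 0 1 2
  have hdom : Integrable (fun z : V3 => K * (1 + 2 * ‖u₁‖ ^ 2 + 2 * θ₁) ^ 2 * (1 + ‖z‖ ^ 2) ^ 2)
      (stdGaussian V3) := hG.const_mul _
  have hc : Continuous fun z : V3 => g (u₁ + Real.sqrt θ₁ • z) := hg.comp (by fun_prop)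
  refine hdom.mono' hc.aestronglyMeasurable (Eventually.of_forall fun z => ?_)
  rw [Real.norm_eq_abs]
  refine (hK _).trans ?_
  have hw := k2r_coupling_norm_sq_le (le_refl ‖u₁‖) hθ₁ (le_refl θ₁) z
  have h0 : 0 ≤ 1 + ‖u₁ + Real.sqrt θ₁ • z‖ ^ 2 := by positivity
  calc K * (1 + ‖u₁ + Real.sqrt θ₁ • z‖ ^ 2) ^ 2
      ≤ K * ((1 + 2 * ‖u₁‖ ^ 2 + 2 * θ₁) * (1 + ‖z‖ ^ 2)) ^ 2 :=
        mul_le_mul_of_nonneg_left (pow_le_pow_left₀ h0 hw 2) hK0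
    _ = K * (1 + 2 * ‖u₁‖ ^ 2 + 2 * θ₁) ^ 2 * (1 + ‖z‖ ^ 2) ^ 2 := by ring

/-! ## The position slice: Fubini `v ↔ ω` and the bounded prefactors -/

/-- **The position slice.** Fix `x ∈ 𝕋³` and the contact shift `y(ω) = x + εω`.  If for every direction
`ω` the Maxwellian-weighted bracket `∫ M_x(v) ∫ ((v−w)·ω)₊ M_{y(ω)}(w) [κ(x,v′) + κ(y,w′) − κ(x,v) − κ(y,w)] dw dv`
is bounded by `B` in absolute value, then the full `v`-slice of the corrector pairing at `x`,
`∫ ρ₀(x) M_x(v) ∫_{S²} ∫ ((v−w)·ω)₊ Y(x,ω) ρ₀(y) M_y(w) [⋯] dw dσ(ω) dv`, is bounded by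
`|ρ₀(x)| · Ȳ R B |S²|` (Fubini `v ↔ ω` under Gaussian-moment domination, then the bounded prefactors
`|Y| ≤ Ȳ`, `|ρ₀| ≤ R`). [folklore] -/
theorem k2r_corrector_position {ρ₀ θ₀ : T3 → ℝ} {u₀ : T3 → V3} (hρc : Continuous ρ₀) (hθc : Continuous θ₀)
    (huc : Continuous u₀) {R Θ U : ℝ} (hρb : ∀ x, |ρ₀ x| ≤ R) (hθpos : ∀ x, 0 < θ₀ x)
    (hθΘ : ∀ x, θ₀ x ≤ Θ) (hub : ∀ x, ‖u₀ x‖ ≤ U) {Yf : T3 → sphere (0 : V3) 1 → ℝ}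
    (hYc : Continuous (uncurry Yf)) {Yb : ℝ} (hYb : ∀ x ω, |Yf x ω| ≤ Yb) {κ : T3 → V3 → ℝ}
    (hκc : Continuous (uncurry κ)) {C : ℝ} (hκb : ∀ x v, |κ x v| ≤ C * (1 + ‖v‖ ^ 2)) (ε : ℝ) (x : T3)
    {B : ℝ} (hB : ∀ ω : sphere (0 : V3) 1,
      |∫ v, localMaxwellian 1 (θ₀ x) (u₀ x) v * ∫ w, max ⟪v - w, (ω : V3)⟫_ℝ 0 *
          localMaxwellian 1 (θ₀ ((Torus.geometry (Fin 3)).translate x (ε • (ω : V3))))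
            (u₀ ((Torus.geometry (Fin 3)).translate x (ε • (ω : V3)))) w *
          (κ x (v - ⟪v - w, (ω : V3)⟫_ℝ • (ω : V3)) +
            κ ((Torus.geometry (Fin 3)).translate x (ε • (ω : V3))) (w + ⟪v - w, (ω : V3)⟫_ℝ • (ω : V3)) -
            κ x v - κ ((Torus.geometry (Fin 3)).translate x (ε • (ω : V3))) w)| ≤ B) :
    |∫ v, ρ₀ x * localMaxwellian 1 (θ₀ x) (u₀ x) v *
        ∫ ω : sphere (0 : V3) 1, (∫ w, max ⟪v - w, (ω : V3)⟫_ℝ 0 * Yf x ω *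
          (ρ₀ ((Torus.geometry (Fin 3)).translate x (ε • (ω : V3))) *
            localMaxwellian 1 (θ₀ ((Torus.geometry (Fin 3)).translate x (ε • (ω : V3))))
              (u₀ ((Torus.geometry (Fin 3)).translate x (ε • (ω : V3)))) w) *
          (κ x (v - ⟪v - w, (ω : V3)⟫_ℝ • (ω : V3)) +
            κ ((Torus.geometry (Fin 3)).translate x (ε • (ω : V3))) (w + ⟪v - w, (ω : V3)⟫_ℝ • (ω : V3)) -
            κ x v - κ ((Torus.geometry (Fin 3)).translate x (ε • (ω : V3))) w)) ∂sphereMeasure| ≤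
      |ρ₀ x| * (Yb * R * B * (sphereMeasure : Measure (sphere (0 : V3) 1)).real univ) := by
  haveI := isFiniteMeasure_sphereMeasure (E := V3)
  obtain ⟨CG, -, hCG⟩ := exists_integral_one_add_norm_sq_sq_gaussMeasure_le U Θ
  have hC : 0 ≤ C := by
    have h := (abs_nonneg _).trans (hκb x 0)
    simpa using h
  have hR0 : 0 ≤ R := (abs_nonneg _).trans (hρb x)
  have hθx := hθpos x
  -- notation
  set M : V3 → ℝ := localMaxwellian 1 (θ₀ x) (u₀ x) with hM
  have hMc : Continuous M := continuous_localMaxwellian 1 _ _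
  set τ : sphere (0 : V3) 1 → T3 := fun ω => (Torus.geometry (Fin 3)).translate x (ε • (ω : V3))
  have hτc : Continuous τ := (continuous_torus_translate_sphere ε).comp (Continuous.prodMk_right x)
  -- the joint integrand `H ((v, ω), w)` and the inner integral `J (v, ω) = ∫ H ((v, ω), w) dw`
  set H : (V3 × sphere (0 : V3) 1) × V3 → ℝ := fun r =>
    max ⟪r.1.1 - r.2, (r.1.2 : V3)⟫_ℝ 0 * uncurry Yf (x, r.1.2) *
      (ρ₀ (τ r.1.2) * localMaxwellian 1 (θ₀ (τ r.1.2)) (u₀ (τ r.1.2)) r.2) *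
      (uncurry κ (x, r.1.1 - ⟪r.1.1 - r.2, (r.1.2 : V3)⟫_ℝ • (r.1.2 : V3)) +
        uncurry κ (τ r.1.2, r.2 + ⟪r.1.1 - r.2, (r.1.2 : V3)⟫_ℝ • (r.1.2 : V3)) -
        uncurry κ (x, r.1.1) - uncurry κ (τ r.1.2, r.2)) with hH
  have hHc : Continuous H := by
    have hv : Continuous fun r : (V3 × sphere (0 : V3) 1) × V3 => r.1.1 := by fun_prop
    have hw : Continuous fun r : (V3 × sphere (0 : V3) 1) × V3 => r.2 := by fun_prop
    have hω : Continuous fun r : (V3 × sphere (0 : V3) 1) × V3 => (r.1.2 : V3) := by fun_prop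
    have hy : Continuous fun r : (V3 × sphere (0 : V3) 1) × V3 => τ r.1.2 := hτc.comp (by fun_prop)
    have hin : Continuous fun r : (V3 × sphere (0 : V3) 1) × V3 => ⟪r.1.1 - r.2, (r.1.2 : V3)⟫_ℝ :=
      (hv.sub hw).inner hω
    have hMy : Continuous fun r : (V3 × sphere (0 : V3) 1) × V3 =>
        localMaxwellian 1 (θ₀ (τ r.1.2)) (u₀ (τ r.1.2)) r.2 :=
      continuous_localMaxwellian_param (hθc.comp hy) (fun _ => hθpos _) (huc.comp hy) hw
    simp only [hH]
    refine (((hin.max continuous_const).mul (hYc.comp (continuous_const.prodMk (by fun_prop)))).mul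
      ((hρc.comp hy).mul hMy)).mul ?_
    exact (((hκc.comp (continuous_const.prodMk (hv.sub (hin.smul hω)))).add
      (hκc.comp (hy.prodMk (hw.add (hin.smul hω))))).sub (hκc.comp (continuous_const.prodMk hv))).sub
      (hκc.comp (hy.prodMk hw))
  set J : V3 × sphere (0 : V3) 1 → ℝ := fun s => ∫ w, H (s, w)
  have hJm : StronglyMeasurable J := hHc.stronglyMeasurable.integral_prod_right'
  have hJeq : ∀ (v : V3) (ω : sphere (0 : V3) 1), J (v, ω) = ∫ w, max ⟪v - w, (ω : V3)⟫_ℝ 0 * Yf x ω *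
      (ρ₀ (τ ω) * localMaxwellian 1 (θ₀ (τ ω)) (u₀ (τ ω)) w) *
      (κ x (v - ⟪v - w, (ω : V3)⟫_ℝ • (ω : V3)) + κ (τ ω) (w + ⟪v - w, (ω : V3)⟫_ℝ • (ω : V3)) -
        κ x v - κ (τ ω) w) := fun v ω => rfl
  -- pointwise bound on the inner integral (Gaussian moment of the partner Maxwellian)
  have hJbd : ∀ (v : V3) (ω : sphere (0 : V3) 1), |J (v, ω)| ≤ Yb * R * (18 * C) * CG * (1 + ‖v‖ ^ 2) ^ 2 := by
    intro v ω
    set y := τ ω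
    have hθy := hθpos y
    have hdom : ∀ w : V3, ‖max ⟪v - w, (ω : V3)⟫_ℝ 0 * Yf x ω *
        (ρ₀ y * localMaxwellian 1 (θ₀ y) (u₀ y) w) *
        (κ x (v - ⟪v - w, (ω : V3)⟫_ℝ • (ω : V3)) + κ y (w + ⟪v - w, (ω : V3)⟫_ℝ • (ω : V3)) -
          κ x v - κ y w)‖ ≤
        localMaxwellian 1 (θ₀ y) (u₀ y) w * (Yb * R * (18 * C) * (1 + ‖v‖ ^ 2) ^ 2 * (1 + ‖w‖ ^ 2) ^ 2) := by
      intro w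
      have hM0 : 0 ≤ localMaxwellian 1 (θ₀ y) (u₀ y) w := localMaxwellian_nonneg zero_le_one hθy.le _ _
      have hmax : |max ⟪v - w, (ω : V3)⟫_ℝ 0| ≤ (1 + ‖v‖ ^ 2) * (1 + ‖w‖ ^ 2) :=
        k2r_abs_posPart_inner_le ω v w
      have hinc := abs_increment_le (φ := κ) hκb x y v w ω
      have hYb0 : 0 ≤ Yb := (abs_nonneg _).trans (hYb x ω)
      have hP0 : 0 ≤ (1 + ‖v‖ ^ 2) * (1 + ‖w‖ ^ 2) := by positivity
      rw [Real.norm_eq_abs, abs_mul, abs_mul, abs_mul, abs_mul, abs_of_nonneg hM0]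
      have i1 : |max ⟪v - w, (ω : V3)⟫_ℝ 0| * |Yf x ω| ≤ ((1 + ‖v‖ ^ 2) * (1 + ‖w‖ ^ 2)) * Yb :=
        mul_le_mul hmax (hYb x ω) (abs_nonneg _) hP0
      have i2 : |ρ₀ y| * localMaxwellian 1 (θ₀ y) (u₀ y) w ≤ R * localMaxwellian 1 (θ₀ y) (u₀ y) w :=
        mul_le_mul_of_nonneg_right (hρb y) hM0
      have i3 : |max ⟪v - w, (ω : V3)⟫_ℝ 0| * |Yf x ω| * (|ρ₀ y| * localMaxwellian 1 (θ₀ y) (u₀ y) w) ≤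
          ((1 + ‖v‖ ^ 2) * (1 + ‖w‖ ^ 2)) * Yb * (R * localMaxwellian 1 (θ₀ y) (u₀ y) w) :=
        mul_le_mul i1 i2 (mul_nonneg (abs_nonneg _) hM0) (mul_nonneg hP0 hYb0)
      calc |max ⟪v - w, (ω : V3)⟫_ℝ 0| * |Yf x ω| * (|ρ₀ y| * localMaxwellian 1 (θ₀ y) (u₀ y) w) *
            |κ x (v - ⟪v - w, (ω : V3)⟫_ℝ • (ω : V3)) + κ y (w + ⟪v - w, (ω : V3)⟫_ℝ • (ω : V3)) -
              κ x v - κ y w|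
          ≤ ((1 + ‖v‖ ^ 2) * (1 + ‖w‖ ^ 2)) * Yb * (R * localMaxwellian 1 (θ₀ y) (u₀ y) w) *
            (18 * C * ((1 + ‖v‖ ^ 2) * (1 + ‖w‖ ^ 2))) :=
            mul_le_mul i3 hinc (abs_nonneg _) (mul_nonneg (mul_nonneg hP0 hYb0) (mul_nonneg hR0 hM0))
        _ = _ := by ring
    have hint : Integrable (fun w : V3 => localMaxwellian 1 (θ₀ y) (u₀ y) w *
        (Yb * R * (18 * C) * (1 + ‖v‖ ^ 2) ^ 2 * (1 + ‖w‖ ^ 2) ^ 2)) := by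
      rw [integrable_localMaxwellian_mul_iff hθy]
      exact (integrable_one_add_norm_sq_pow_gaussMeasure _ _ 2).const_mul _
    have h := norm_integral_le_of_norm_le hint (Eventually.of_forall hdom)
    rw [Real.norm_eq_abs, integral_localMaxwellian_mul_eq_integral_gaussMeasure hθy, integral_const_mul] at h
    rw [hJeq]
    refine h.trans ?_
    have hCGy := hCG (u₀ y) (θ₀ y) (hub y) hθy (hθΘ y)
    have hYb0 : 0 ≤ Yb := (abs_nonneg _).trans (hYb x ω)
    have : 0 ≤ Yb * R * (18 * C) * (1 + ‖v‖ ^ 2) ^ 2 := by positivity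
    nlinarith
  -- integrability of `(v, ω) ↦ M v * J (v, ω)` on `ℝ³ × S²`
  have hm₂ : Integrable (fun v : V3 => M v * (1 + ‖v‖ ^ 2) ^ 2) := by
    rw [hM, integrable_localMaxwellian_mul_iff hθx]
    exact integrable_one_add_norm_sq_pow_gaussMeasure _ _ 2
  have hGi : Integrable (uncurry fun (v : V3) (ω : sphere (0 : V3) 1) => M v * J (v, ω))
      ((volume : Measure V3).prod sphereMeasure) := by
    have hbnd : Integrable (fun s : V3 × sphere (0 : V3) 1 =>
        Yb * R * (18 * C) * CG * (M s.1 * (1 + ‖s.1‖ ^ 2) ^ 2)) ((volume : Measure V3).prod sphereMeasure) :=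
      (hm₂.comp_fst sphereMeasure).const_mul _
    refine hbnd.mono' ?_ (Eventually.of_forall fun s => ?_)
    · exact ((hMc.comp continuous_fst).aestronglyMeasurable).mul hJm.aestronglyMeasurable
    · obtain ⟨v, ω⟩ := s
      have hMv : 0 ≤ M v := localMaxwellian_nonneg zero_le_one hθx.le _ v
      simp only [Function.uncurry_apply_pair]
      rw [Real.norm_eq_abs, abs_mul, abs_of_nonneg hMv]
      calc M v * |J (v, ω)| ≤ M v * (Yb * R * (18 * C) * CG * (1 + ‖v‖ ^ 2) ^ 2) :=
            mul_le_mul_of_nonneg_left (hJbd v ω) hMv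
        _ = Yb * R * (18 * C) * CG * (M v * (1 + ‖v‖ ^ 2) ^ 2) := by ring
  -- the bound for each direction `ω`
  have hωbd : ∀ ω : sphere (0 : V3) 1, |∫ v, M v * J (v, ω)| ≤ Yb * R * B := by
    intro ω
    have hYb0 : 0 ≤ Yb := (abs_nonneg _).trans (hYb x ω)
    have hJfac : ∀ v : V3, J (v, ω) = (Yf x ω * ρ₀ (τ ω)) *
        ∫ w, max ⟪v - w, (ω : V3)⟫_ℝ 0 * localMaxwellian 1 (θ₀ (τ ω)) (u₀ (τ ω)) w *
          (κ x (v - ⟪v - w, (ω : V3)⟫_ℝ • (ω : V3)) + κ (τ ω) (w + ⟪v - w, (ω : V3)⟫_ℝ • (ω : V3)) -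
            κ x v - κ (τ ω) w) := by
      intro v
      rw [hJeq, ← integral_const_mul]
      refine integral_congr_ae (Eventually.of_forall fun w => ?_)
      ring
    have hfac : ∫ v, M v * J (v, ω) = (Yf x ω * ρ₀ (τ ω)) *
        ∫ v, M v * ∫ w, max ⟪v - w, (ω : V3)⟫_ℝ 0 * localMaxwellian 1 (θ₀ (τ ω)) (u₀ (τ ω)) w *
          (κ x (v - ⟪v - w, (ω : V3)⟫_ℝ • (ω : V3)) + κ (τ ω) (w + ⟪v - w, (ω : V3)⟫_ℝ • (ω : V3)) -
            κ x v - κ (τ ω) w) := by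
      rw [← integral_const_mul]
      refine integral_congr_ae (Eventually.of_forall fun v => ?_)
      simp only [hJfac]
      ring
    rw [hfac, abs_mul, abs_mul]
    exact mul_le_mul (mul_le_mul (hYb x ω) (hρb _) (abs_nonneg _) hYb0) (hB ω) (abs_nonneg _)
      (mul_nonneg hYb0 hR0)
  -- assembly
  have hswap := integral_integral_swap hGi
  simp only at hswap
  have hωint := norm_integral_le_of_norm_le_const (μ := (sphereMeasure : Measure (sphere (0 : V3) 1)))
    (f := fun ω => ∫ v, M v * J (v, ω)) (C := Yb * R * B)
    (Eventually.of_forall fun ω => by rw [Real.norm_eq_abs]; exact hωbd ω)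
  rw [Real.norm_eq_abs] at hωint
  have key : ∫ v, ρ₀ x * M v * ∫ ω : sphere (0 : V3) 1, J (v, ω) ∂sphereMeasure =
      ρ₀ x * ∫ ω : sphere (0 : V3) 1, (∫ v, M v * J (v, ω)) ∂sphereMeasure := by
    rw [← hswap, ← integral_const_mul]
    refine integral_congr_ae (Eventually.of_forall fun v => ?_)
    simp only
    rw [integral_const_mul, mul_assoc]
  change |∫ v, ρ₀ x * M v * ∫ ω : sphere (0 : V3) 1, J (v, ω) ∂sphereMeasure| ≤ _
  rw [key, abs_mul]
  exact mul_le_mul_of_nonneg_left hωint (abs_nonneg _)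
/-! ## Registered sub-goal of stub `stub_correctorBalance` proved in this file -/

/-- **Registered sub-goal `stub_correctorBalance_position`** (K2R line `birth`, stub B4, helper II): the
position slice `k2r_corrector_position`, as a closed statement. [folklore] -/
theorem stub_correctorBalance_position :
    ∀ (ρ₀ θ₀ : UnitAddTorus (Fin 3) → ℝ) (u₀ : UnitAddTorus (Fin 3) → EuclideanSpace ℝ (Fin 3)),
    Continuous ρ₀ → Continuous θ₀ → Continuous u₀ → ∀ (R Θ U : ℝ),
    (∀ x, |ρ₀ x| ≤ R) → (∀ x, 0 < θ₀ x) → (∀ x, θ₀ x ≤ Θ) → (∀ x, ‖u₀ x‖ ≤ U) →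
    ∀ (Yf : UnitAddTorus (Fin 3) → Metric.sphere (0 : EuclideanSpace ℝ (Fin 3)) 1 → ℝ),
    Continuous (Function.uncurry Yf) → ∀ (Yb : ℝ), (∀ x ω, |Yf x ω| ≤ Yb) →
    ∀ (κ : UnitAddTorus (Fin 3) → EuclideanSpace ℝ (Fin 3) → ℝ), Continuous (Function.uncurry κ) → ∀ (C : ℝ),
    (∀ x v, |κ x v| ≤ C * (1 + ‖v‖ ^ 2)) → ∀ (ε : ℝ) (x : UnitAddTorus (Fin 3)) (B : ℝ),
    (∀ ω : Metric.sphere (0 : EuclideanSpace ℝ (Fin 3)) 1,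
      |∫ v : EuclideanSpace ℝ (Fin 3), Literature.Analysis.FluidPDE.localMaxwellian 1 (θ₀ x) (u₀ x) v *
          ∫ w : EuclideanSpace ℝ (Fin 3), max (inner ℝ (v - w) ω) 0 *
          Literature.Analysis.FluidPDE.localMaxwellian 1 (θ₀ ((Literature.Analysis.FluidPDE.Torus.geometry (Fin 3)).translate x (ε • (ω : EuclideanSpace ℝ (Fin 3))))) (u₀ ((Literature.Analysis.FluidPDE.Torus.geometry (Fin 3)).translate x (ε • (ω : EuclideanSpace ℝ (Fin 3))))) w *
          (κ x (v - inner ℝ (v - w) ω • (ω : EuclideanSpace ℝ (Fin 3))) +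
            κ ((Literature.Analysis.FluidPDE.Torus.geometry (Fin 3)).translate x (ε • (ω : EuclideanSpace ℝ (Fin 3)))) (w + inner ℝ (v - w) ω • (ω : EuclideanSpace ℝ (Fin 3))) - κ x v - κ ((Literature.Analysis.FluidPDE.Torus.geometry (Fin 3)).translate x (ε • (ω : EuclideanSpace ℝ (Fin 3)))) w)| ≤ B) →
    |∫ v : EuclideanSpace ℝ (Fin 3), ρ₀ x * Literature.Analysis.FluidPDE.localMaxwellian 1 (θ₀ x) (u₀ x) v *
        ∫ ω : Metric.sphere (0 : EuclideanSpace ℝ (Fin 3)) 1, (∫ w : EuclideanSpace ℝ (Fin 3),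
          max (inner ℝ (v - w) ω) 0 * Yf x ω *
          (ρ₀ ((Literature.Analysis.FluidPDE.Torus.geometry (Fin 3)).translate x (ε • (ω : EuclideanSpace ℝ (Fin 3)))) * Literature.Analysis.FluidPDE.localMaxwellian 1 (θ₀ ((Literature.Analysis.FluidPDE.Torus.geometry (Fin 3)).translate x (ε • (ω : EuclideanSpace ℝ (Fin 3))))) (u₀ ((Literature.Analysis.FluidPDE.Torus.geometry (Fin 3)).translate x (ε • (ω : EuclideanSpace ℝ (Fin 3))))) w) *
          (κ x (v - inner ℝ (v - w) ω • (ω : EuclideanSpace ℝ (Fin 3))) +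
            κ ((Literature.Analysis.FluidPDE.Torus.geometry (Fin 3)).translate x (ε • (ω : EuclideanSpace ℝ (Fin 3)))) (w + inner ℝ (v - w) ω • (ω : EuclideanSpace ℝ (Fin 3))) - κ x v - κ ((Literature.Analysis.FluidPDE.Torus.geometry (Fin 3)).translate x (ε • (ω : EuclideanSpace ℝ (Fin 3)))) w))
        ∂Literature.MathematicalPhysics.KineticTheory.sphereMeasure| ≤
      |ρ₀ x| * (Yb * R * B * (Literature.MathematicalPhysics.KineticTheory.sphereMeasure :
        MeasureTheory.Measure (Metric.sphere (0 : EuclideanSpace ℝ (Fin 3)) 1)).real Set.univ) :=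
  fun _ _ _ hρc hθc huc _ _ _ hρb hθpos hθΘ hub _ hYc _ hYb _ hκc _ hκb ε x _ hB =>
    k2r_corrector_position hρc hθc huc hρb hθpos hθΘ hub hYc hYb hκc hκb ε x hB

end Summit.AtomisticToContinuum.HydrodynamicLimit.Theorems.EnskogAdjointDuality

end
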